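import Literature.AlgebraicGeometry.HodgeTheory.KunnethStandardConjectureDominations
import HarnessLib

/-!
# `g_* ∘ Lʳ_η ∘ g^* = c · id` with `c ≠ 0`: the cohomology of the target is a direct summand of the
# cohomology of the source along every surjective morphism (Voisin I Lemma 7.28 / Remark 7.29 in
# positive relative dimension)

Family `hodge`, layer `Literature/AlgebraicGeometry/HodgeTheory`; lane `lit-hodgefound`. THEOREMS ONLY
(no definition, no named fact; D-0026). C. Voisin, *Hodge Theory and Complex Algebraic Geometry I*
(2002), §7.3.2: Lemma 7.28 ("`φ : X → Y` surjective holomorphic, `X` compact Kähler ⟹ `φ^*` injective",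
proved through `∫_X φ^*η ∧ ωʳ ≠ 0`, p. 150) and Remark 7.29 ("when `φ` has finite generic fibre of
cardinal `d` … `φ_* ∘ φ^* = d Id`"). For a surjective morphism `g : X ⟶ W` of smooth projective complex
varieties of RELATIVE DIMENSION `r = dim X − dim W` the finite-degree formula becomes, after cupping
with the `r`-th power of a Kähler class `η` of `X`,

  `g_* (ηʳ ∪ g^* α) = g_*(ηʳ) ∪ α = c · α`, `c ≠ 0`

(projection formula, Fulton *Young Tableaux* App. B (6); `g_*(ηʳ) = c · 1_W ≠ 0` is the tree's
`KaehlerRationalDatum.complexGysin_lefschetzPow_one_ne_zero_of_surjective`, Lemma 7.28 with the wedge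
kept). This is the cohomological shadow of "`h(W)` is a direct summand of `h(X)`" (the hypothesis of
Kahn's Lemma 6.30 (2)) realised by the correspondences `ᵗΓ_g` and `c⁻¹ Γ_g ∘ (ηʳ ∪ –)`.

* §1 `complexGysin_lefschetzPow_map_eq_smul` — **`g_*(Lʳ_η(g^* α)) = c • α` for EVERY `η ∈ H²(X(ℂ))`,
  every morphism `g`, every degree, where `g_*(Lʳ_η 1) = c • 1`** (projection formula and graded
  commutativity; no surjectivity needed);
* §2 for `g` SURJECTIVE and `η` the rational Kähler class of a Kähler–rational datum `D` (`c ≠ 0`):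
  `KaehlerRationalDatum.exists_complexGysin_lefschetzPow_map_eq_smul_of_surjective`,
  **`KaehlerRationalDatum.lefschetzPow_map_injective_of_surjective`** (`α ↦ Lʳ_η(g^* α)` is injective
  on EVERY `Hᵏ(W(ℂ); ℂ)` — Lemma 7.28 strengthened by the factor `ηʳ`),
  `KaehlerRationalDatum.complexGysin_comp_lefschetzPow_surjective`,
  **`KaehlerRationalDatum.isCompl_range_map_ker_complexGysin_lefschetzPow`** (`Hᵏ(X) = g^* Hᵏ(W) ⊕
  ker (g_* ∘ Lʳ_η)`: `Hᵏ(W)` is a direct summand of `Hᵏ(X)`);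
* §3 datum-free forms with a DIVISOR class `η ∈ N¹ H²(X)`:
  `exists_mem_algebraicClasses_one_complexGysin_lefschetzPow_map_eq_smul_of_surjective`.

## References

* [Voisin2002] [VoisinHodgeI2002] C. Voisin, Hodge Theory and Complex Algebraic Geometry I, CUP 2002,
  §7.3.2 Lemma 7.28 (p. 150) and Remark 7.29.
* [FultonYoungTableaux1997] W. Fulton, Young Tableaux, CUP 1997, Appendix B §B.1 (5)–(7).
* [Kahn2020] B. Kahn, Zeta and L-functions of varieties and motives, CUP 2020, §6.9 Lemma 6.30 (2)
  (p. 125), proof of Theorem 6.31 (1) (`p'^* f_* i_X^* = deg f · 1`).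
* [HatcherAT2002] A. Hatcher, Algebraic Topology, CUP 2002, §3.2 p. 211 and Thm. 3.11.
-/

noncomputable section

open CategoryTheory AlgebraicGeometry
open Literature.AlgebraicTopology.SingularHomology Literature.Geometry.Kaehler
open Literature.AlgebraicGeometry.Motives (IsSmoothProjective ComplexPoints)

namespace Literature.AlgebraicGeometry.HodgeTheory

variable {n m : ℕ} {X W : Motives.SchemeOver ℂ}

/-! ### §1 `g_*(Lʳ_η(g^* α)) = c • α` from `g_*(Lʳ_η 1) = c • 1` (projection formula) -/

/-- **`Lʳ_η z = z ∪ Lʳ_η 1`** in the free target degree `k + 2r` (the Lefschetz iterate is cup product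
with `ηʳ = Lʳ_η 1`; classes of even degree are central). [cite: HatcherAT2002, §3.2 p. 211 and Thm. 3.11] -/
theorem lefschetzPow_eq_cupProduct_lefschetzPow_one (η : complexBetti X 2) (r : ℕ) {k : ℕ}
    (z : complexBetti X k) :
    lefschetzPow η r k z =
      cupProduct (show k + (0 + 2 * r) = k + 2 * r by omega) z
        (lefschetzPow η r 0 (singularCohomology.one ℂ (ComplexPoints X))) := by
  rw [cupProduct_gradedComm_holds ℂ _ (show k + (0 + 2 * r) = k + 2 * r by omega)
    (show (0 + 2 * r) + k = k + 2 * r by omega), cupProduct_lefschetzPow_one, complexBetti.degCast_rfl,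
    (show Even (k * (0 + 2 * r)) from ⟨k * r, by ring⟩).neg_one_pow, one_smul]

/-- **`g_*(Lʳ_η(g^* α)) = c • α`** for a morphism `g : X ⟶ W` of smooth projective complex varieties,
`dim X = dim W + r`, ANY class `η ∈ H²(X(ℂ); ℂ)` and the scalar `c` with `g_*(Lʳ_η 1_X) = c • 1_W`
(`H⁰(W(ℂ)) = ℂ · 1`): the projection formula `g_*(g^* α ∪ y) = α ∪ g_* y` (Fulton App. B (6), the
tree's `complexGysin_cup`) with `y = ηʳ`. In print for generically finite `g` (`r = 0`): `φ_* φ^* = d Id`.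
[cite: Voisin2002, §7.3.2 Remark 7.29] [cite: FultonYoungTableaux1997, Appendix B §B.1 (6)] -/
theorem complexGysin_lefschetzPow_map_eq_smul (hX : IsSmoothProjective n X) (hW : IsSmoothProjective m W)
    (g : X ⟶ W) {r : ℕ} (hr : m + r = n) (η : complexBetti X 2) {c : ℂ}
    (hc : complexGysin complexOrientationFamily hX hW g (show (0 + 2 * r) + 2 * m = 0 + 2 * n by omega)
      (lefschetzPow η r 0 (singularCohomology.one ℂ (ComplexPoints X))) =
      c • singularCohomology.one ℂ (ComplexPoints W))
    {k : ℕ} (α : complexBetti W k) :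
    complexGysin complexOrientationFamily hX hW g (show (k + 2 * r) + 2 * m = k + 2 * n by omega)
      (lefschetzPow η r k (complexBetti.map g k α)) = c • α := by
  rw [lefschetzPow_eq_cupProduct_lefschetzPow_one,
    complexGysin_cup hasPoincareDuality_complexOrientationFamily hX hW g
      (show k + (0 + 2 * r) = k + 2 * r by omega) _ (show (0 + 2 * r) + 2 * m = 0 + 2 * n by omega)
      (Nat.add_zero k),
    hc, map_smul, cupProduct_one]

/-- **`g_*(Lʳ_η(g^* α)) ≠ 0` for `α ≠ 0` when `g_*(Lʳ_η 1) ≠ 0`** (the scalar `c` is then non-zero).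
[cite: Voisin2002, §7.3.2 Lemma 7.28 and Remark 7.29] -/
theorem complexGysin_lefschetzPow_map_ne_zero (hX : IsSmoothProjective n X) (hW : IsSmoothProjective m W)
    (g : X ⟶ W) {r : ℕ} (hr : m + r = n) (η : complexBetti X 2)
    (hne : complexGysin complexOrientationFamily hX hW g (show (0 + 2 * r) + 2 * m = 0 + 2 * n by omega)
      (lefschetzPow η r 0 (singularCohomology.one ℂ (ComplexPoints X))) ≠ 0)
    {k : ℕ} {α : complexBetti W k} (hα : α ≠ 0) :
    complexGysin complexOrientationFamily hX hW g (show (k + 2 * r) + 2 * m = k + 2 * n by omega)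
      (lefschetzPow η r k (complexBetti.map g k α)) ≠ 0 := by
  obtain ⟨c, hc⟩ := exists_eq_smul_one complexOrientationFamily hW
    (complexGysin complexOrientationFamily hX hW g (show (0 + 2 * r) + 2 * m = 0 + 2 * n by omega)
      (lefschetzPow η r 0 (singularCohomology.one ℂ (ComplexPoints X))))
  have hc0 : c ≠ 0 := by
    rintro rfl
    exact hne (by rw [hc, zero_smul])
  rw [complexGysin_lefschetzPow_map_eq_smul hX hW g hr η hc]
  exact smul_ne_zero hc0 hα

/-! ### §2 Surjective `g`: the rational Kähler class of a Kähler–rational datum -/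

namespace KaehlerRationalDatum

variable (D : KaehlerRationalDatum n X)

/-- **`g_* ∘ Lʳ_η ∘ g^* = c · id` with `c ≠ 0` along a SURJECTIVE `g : X ⟶ W`**, `dim X = dim W + r`,
`η = D.Hη` the rational Kähler class of a Kähler–rational datum of `X`: there is `c ≠ 0` with
`g_*(Lʳ_η(g^* α)) = c • α` for all `α ∈ Hᵏ(W(ℂ); ℂ)` and all `k` (`g_*(ηʳ) = c · 1 ≠ 0` by Voisin's
Lemma 7.28 with the wedge kept, `complexGysin_lefschetzPow_one_ne_zero_of_surjective`).
[cite: Voisin2002, §7.3.2 Lemma 7.28 and Remark 7.29] [cite: FultonYoungTableaux1997, Appendix B §B.1 (6)] -/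
theorem exists_complexGysin_lefschetzPow_map_eq_smul_of_surjective (hX : IsSmoothProjective n X)
    (hW : IsSmoothProjective m W) (g : X ⟶ W) [Surjective g.left] {r : ℕ} (hr : m + r = n) :
    ∃ c : ℂ, c ≠ 0 ∧ ∀ (k : ℕ) (α : complexBetti W k),
      complexGysin complexOrientationFamily hX hW g (show (k + 2 * r) + 2 * m = k + 2 * n by omega)
        (lefschetzPow D.Hη r k (complexBetti.map g k α)) = c • α := by
  obtain ⟨c, hc⟩ := exists_eq_smul_one complexOrientationFamily hW
    (complexGysin complexOrientationFamily hX hW g (show (0 + 2 * r) + 2 * m = 0 + 2 * n by omega)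
      (lefschetzPow D.Hη r 0 (singularCohomology.one ℂ (ComplexPoints X))))
  have hc0 : c ≠ 0 := by
    rintro rfl
    exact D.complexGysin_lefschetzPow_one_ne_zero_of_surjective hX hW g hr (by rw [hc, zero_smul])
  exact ⟨c, hc0, fun k α ↦ complexGysin_lefschetzPow_map_eq_smul hX hW g hr D.Hη hc α⟩

/-- **Lemma 7.28 strengthened: `α ↦ Lʳ_η(g^* α)` is injective on every `Hᵏ(W(ℂ); ℂ)`** for
`g : X ⟶ W` surjective of relative dimension `r` (a left inverse is `c⁻¹ g_*`). For `k = 2 dim W` this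
is `lefschetzPow_map_ne_zero_of_surjective`; Voisin's printed statement is the case without `ηʳ`.
[cite: Voisin2002, §7.3.2 Lemma 7.28] -/
theorem lefschetzPow_map_injective_of_surjective (hX : IsSmoothProjective n X)
    (hW : IsSmoothProjective m W) (g : X ⟶ W) [Surjective g.left] {r : ℕ} (hr : m + r = n) (k : ℕ) :
    Function.Injective fun α : complexBetti W k ↦ lefschetzPow D.Hη r k (complexBetti.map g k α) := by
  obtain ⟨c, hc0, hc⟩ := D.exists_complexGysin_lefschetzPow_map_eq_smul_of_surjective hX hW g hr
  intro α β hαβ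
  have h := congrArg (complexGysin complexOrientationFamily hX hW g
    (show (k + 2 * r) + 2 * m = k + 2 * n by omega)) hαβ
  simp only [hc] at h
  exact smul_right_injective _ hc0 h

/-- **`g_* ∘ Lʳ_η : H^k(X(ℂ); ℂ) → Hᵏ(W(ℂ); ℂ)` is onto** (a right inverse is `c⁻¹ g^*`).
[cite: Voisin2002, §7.3.2 Lemma 7.28 and Remark 7.29] -/
theorem complexGysin_comp_lefschetzPow_surjective (hX : IsSmoothProjective n X)
    (hW : IsSmoothProjective m W) (g : X ⟶ W) [Surjective g.left] {r : ℕ} (hr : m + r = n) (k : ℕ) :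
    Function.Surjective fun x : complexBetti X k ↦
      complexGysin complexOrientationFamily hX hW g (show (k + 2 * r) + 2 * m = k + 2 * n by omega)
        (lefschetzPow D.Hη r k x) := by
  obtain ⟨c, hc0, hc⟩ := D.exists_complexGysin_lefschetzPow_map_eq_smul_of_surjective hX hW g hr
  intro α
  refine ⟨c⁻¹ • complexBetti.map g k α, ?_⟩
  simp only [map_smul, hc, smul_smul, inv_mul_cancel₀ hc0, one_smul]

/-- **`Hᵏ(W(ℂ); ℂ)` is a direct summand of `Hᵏ(X(ℂ); ℂ)` along every surjection:
`Hᵏ(X) = g^* Hᵏ(W) ⊕ ker (g_* ∘ Lʳ_η)`** (the idempotent `c⁻¹ g^* g_* Lʳ_η` of `Hᵏ(X)` has image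
`g^* Hᵏ(W) ≅ Hᵏ(W)`). This is the cohomological form of "`h(W)` is a direct summand of `h(X)`", the
hypothesis of Kahn's Lemma 6.30 (2). [cite: Voisin2002, §7.3.2 Lemma 7.28 and Remark 7.29]
[cite: Kahn2020, §6.9 Lemma 6.30 (2)] -/
theorem isCompl_range_map_ker_complexGysin_lefschetzPow (hX : IsSmoothProjective n X)
    (hW : IsSmoothProjective m W) (g : X ⟶ W) [Surjective g.left] {r : ℕ} (hr : m + r = n) (k : ℕ) :
    IsCompl (LinearMap.range (complexBetti.map g k).hom)
      (LinearMap.ker (complexGysin complexOrientationFamily hX hW g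
          (show (k + 2 * r) + 2 * m = k + 2 * n by omega) ∘ₗ lefschetzPow D.Hη r k)) := by
  obtain ⟨c, hc0, hc⟩ := D.exists_complexGysin_lefschetzPow_map_eq_smul_of_surjective hX hW g hr
  set P := complexGysin complexOrientationFamily hX hW g
    (show (k + 2 * r) + 2 * m = k + 2 * n by omega) ∘ₗ lefschetzPow D.Hη r k with hP
  have hPg : ∀ α : complexBetti W k, P (complexBetti.map g k α) = c • α := fun α ↦ by
    rw [hP, LinearMap.comp_apply, hc]
  refine IsCompl.of_eq ?_ ?_
  · -- `g^* H(W) ∩ ker P = 0`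
    rw [Submodule.eq_bot_iff]
    rintro x ⟨⟨α, rfl⟩, hx⟩
    change P (complexBetti.map g k α) = 0 at hx
    rw [hPg] at hx
    have hα : α = 0 := (smul_eq_zero.1 hx).resolve_left hc0
    change complexBetti.map g k α = 0
    rw [hα, map_zero]
  · -- `x = c⁻¹ g^*(P x) + (x - c⁻¹ g^*(P x))`
    rw [Submodule.eq_top_iff']
    intro x
    have hx : x = c⁻¹ • complexBetti.map g k (P x) + (x - c⁻¹ • complexBetti.map g k (P x)) := by abel
    rw [hx]
    refine Submodule.add_mem_sup (Submodule.smul_mem _ _ ⟨P x, rfl⟩) ?_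
    rw [LinearMap.mem_ker, map_sub, map_smul, hPg, smul_smul, inv_mul_cancel₀ hc0, one_smul, sub_self]

end KaehlerRationalDatum

/-! ### §3 Datum-free forms: a divisor class `η ∈ N¹ H²(X)` -/

/-- **Along every surjective morphism `g : X ⟶ W` of smooth projective complex varieties
(`dim X = dim W + r`) there are a DIVISOR class `η ∈ N¹ H²(X(ℂ); ℂ)` and `c ≠ 0` with
`g_*(ηʳ ∪ g^* α) = c • α` for all `α`** — so `g^*` is injective, `g_* ∘ Lʳ_η` is onto, and `H•(W)`
is a direct summand of `H•(X)` through algebraic correspondences (`ᵗΓ_g`, `c⁻¹ Γ_g ∘ (ηʳ ∪ –)`).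
[cite: Voisin2002, §7.3.2 Lemma 7.28 and Remark 7.29] [cite: Kahn2020, §6.9 Lemma 6.30 (2)]
[cite: FultonYoungTableaux1997, Appendix B §B.1 (6)] -/
theorem exists_mem_algebraicClasses_one_complexGysin_lefschetzPow_map_eq_smul_of_surjective
    (hX : IsSmoothProjective n X) (hW : IsSmoothProjective m W) (g : X ⟶ W) [Surjective g.left]
    {r : ℕ} (hr : m + r = n) :
    ∃ η ∈ algebraicClasses X 1, ∃ c : ℂ, c ≠ 0 ∧ ∀ (k : ℕ) (α : complexBetti W k),
      complexGysin complexOrientationFamily hX hW g (show (k + 2 * r) + 2 * m = k + 2 * n by omega)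
        (lefschetzPow η r k (complexBetti.map g k α)) = c • α := by
  obtain ⟨D⟩ := nonempty_kaehlerRationalDatum hX
  obtain ⟨c, hc0, hc⟩ := D.exists_complexGysin_lefschetzPow_map_eq_smul_of_surjective hX hW g hr
  exact ⟨D.Hη, D.ofRatClass_eta_mem_algebraicClasses hX, c, hc0, hc⟩

end Literature.AlgebraicGeometry.HodgeTheory

end
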